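import Summits.HodgeConjecture.HodgeConjecture.Theorems.F0P3cStCharTSCharTorusValue        -- ★∕filed (this seat) ④b part 1: `exists_exponents_char_torusChart`; brings ShellsTTLevels ∕ HyperbolicCore ∕ HTwoOfPsi ∕ PsmTransport ∕ VanDijkWeylSymm ∕ K0WeylG
import Summits.HodgeConjecture.HodgeConjecture.Theorems.F0P3cStCharTSL1MSplit              -- ★ p850770 (LH6-p01 g3) «(L1M) SPLIT»: the `hC` binder of record, `unitModulusChar_inv`
import Summits.HodgeConjecture.HodgeConjecture.Theorems.F0P3cStCharTSExpShellDecay         -- ★ (LH6-p03 g3) ④a «EXP-SHELL-DECAY»: `exists_shellDecay_min_of_exponents_of_valued` (the dominant half)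
import HarnessLib

/-!
# F0 · P3c · line LH6 «StCharTS» — «DEC-SIGMA★» (road (L1M) ④b part 2): the `ω`-half bookkeeping — a shell-decay bound on the DOMINANT half of `M ∖ M_c` for
# `Θσ := (Δ∘ι).re · (Θ∘ι)` with `Θ` a class function at regular points holds on ALL of `M ∖ M_c` [Rogawski1990, §12.7 L. 12.7.2 (proof) p. 193; §12.2 p. 173]

Cell `pub/hodgecm-mathlib`, crux H413 = `stmt-HodgeConjecture-24833` (`--supports`, helper lane), route HCCMUnconditional; seat LH6-p05 (g3); desk F0P3-plan (g15)
09:14:01Z ∕ 09:18:17Z (shape of record = the `hC` binder of ★ `F0P3cStCharTSL1MSplit.integrable_of_compactPart_bound_of_shell_decay`).  THEOREMS ONLY, sorry-free,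
★-only imports, no definition ∕ instance ∕ notation ∕ named fact.

THE MATHEMATICS.  `ω(α, z) = (σ(α)⁻¹, z)` swaps the two halves `|α_w| < 1` ∕ `|α_w| > 1` of `M ∖ M_c`, preserves `min(‖α‖, ‖α‖⁻¹)` (`‖σ(α)⁻¹‖ = ‖α‖⁻¹`), and
`ι(ω m) = w₀ ι(m) w₀⁻¹` (★ `torusChart_reflect`); van Dijk's weight is `W`-invariant (★ `vanDijkWeight_weylConj`) and a class function `Θ` (at the REGULAR point `ι m`,
`m ∉ M_c`, ★ (H2c)(H3″)) has `Θ(ι(ω m)) = Θ(ι m)`.  Hence a bound `‖Θσ m‖ ≤ C·min(‖m.1‖, ‖m.1‖⁻¹)^s` on the dominant half extends to all of `M ∖ M_c`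
(`shellDecay_of_dominant_half`).  With ★ part 1 (`exists_exponents_char_torusChart`) and LH6-p03 (g3)'s ④a «EXP-SHELL-DECAY★» (the dominant half) this gives (DEC σ) of
LH6-p01 (g3)'s (TOR⁵) — assembled in `dec_sigma` below once ④a is ★.
HONEST LABEL: count-neutral; HC_CM is proved only modulo the 7 printed citations (2 remaining: hLiu418 = stmt-HodgeConjecture-24832, h413 = stmt-HodgeConjecture-24833)
until rung 0 closes.

## References
* [Rogawski1990] J. D. Rogawski, *Automorphic Representations of Unitary Groups in Three Variables*, Ann. of Math. Stud. 123 (1990): §12.7 L. 12.7.2 (proof) p. 193; §12.2 p. 173.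
* [vanDijk1972] G. van Dijk, *Computation of certain induced characters of p-adic groups*, Math. Ann. 199 (1972), §2.
-/

set_option autoImplicit false
-- the mandated namespace has the single-problem summit's repeated segment (`HodgeConjecture.HodgeConjecture`)
set_option linter.dupNamespace false

noncomputable section

open NumberField IsDedekindDomain MeasureTheory Measure Topology Filter
open scoped NNReal ENNReal Pointwise MatrixGroups
open Literature.NumberTheory Literature.NumberTheory.Rogawski1990 Literature.NumberTheory.Automorphic Literature.NumberTheory.Automorphic.UnitaryGroup
open Summit.HodgeConjecture.HodgeConjecture.Cruxes.H413 Summit.HodgeConjecture.HodgeConjecture.Cruxes.H413.F0P3cStCharTSTorusDefs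

namespace Summit.HodgeConjecture.HodgeConjecture.Cruxes.H413.F0P3cStCharTSDecSigma

variable (L : Type) [Field L] [NumberField L] [IsCMField L] (v : HeightOneSpectrum (𝓞 ↥(maximalRealSubfield L)))

/-- **`‖(ω m).1‖ = ‖m.1‖⁻¹`** (`(ω m).1 = σ(m.1)⁻¹`, `‖σ(u)‖ = ‖u‖` at the one place of a non-split `v`). [cite: Rogawski1990, §12.2 p. 173] -/
theorem unitModulusChar_reflect_fst (w : PlacesOver L v) (hw : IsCMField.complexConj L • w.1 = w.1)
    (m : ((LocalRing L v)ˣ × ↥(normOneUnits (conjLocal L (IsCMField.complexConj L) v)))) :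
    unitModulusChar (LocalRing L v) ((Units.map ((conjLocal L (IsCMField.complexConj L) v : LocalRing L v →+* LocalRing L v) : LocalRing L v →* LocalRing L v) m.1)⁻¹) =
      (unitModulusChar (LocalRing L v) m.1)⁻¹ := by
  rw [F0P3cStCharTSL1MSplit.unitModulusChar_inv, F0P3cStCharTSShellWeight.unitModulusChar_eq_normAbs L v w hw,
    F0P3cStCharTSShellWeight.unitModulusChar_eq_normAbs L v w hw, Units.coe_map, MonoidHom.coe_coe,
    F0P3cStCharTSShellWeight.normAbs_conjLocal_apply L v w hw]

set_option maxHeartbeats 1600000 in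
/-- **THE `ω`-HALF**: for `Θ` a class function at the regular elements of `U(Φ₃)(L⁺_v)`, a bound `‖(Δ(ι m)).re · Θ(ι m)‖ ≤ C·min(‖m.1‖, ‖m.1‖⁻¹)^s` on the
DOMINANT half `{m ∉ M_c | |m.1_w| < 1}` holds on all of `M ∖ M_c`. [cite: Rogawski1990, §12.7 L. 12.7.2 (proof) p. 193; §12.2 p. 173] [cite: vanDijk1972, §2] -/
theorem shellDecay_of_dominant_half (hns : ∀ w' : PlacesOver L v, IsCMField.complexConj L • w'.1 = w'.1) (w : PlacesOver L v)
    (Θ : Gqs L v → ℂ) (hΘcl : ∀ g : Gqs L v, IsRegularElt (g.val : GL (Fin 3) (LocalRing L v)) → ∀ h : Gqs L v, Θ (h * g * h⁻¹) = Θ g)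
    {C s : ℝ}
    (hdom : ∀ m : ((LocalRing L v)ˣ × ↥(normOneUnits (conjLocal L (IsCMField.complexConj L) v))),
      m ∉ (((Submonoid.pi Set.univ (fun w : PlacesOver L v => (w.1.adicCompletionIntegers L).toSubring.toSubmonoid)).units.prod (⊤ : Subgroup ↥(normOneUnits (conjLocal L (IsCMField.complexConj L) v)))) : Subgroup ((LocalRing L v)ˣ × ↥(normOneUnits (conjLocal L (IsCMField.complexConj L) v)))) →
      Valued.v ((m.1 : LocalRing L v) w) < 1 →
        ‖(((vanDijkWeight L v (torusChart L v m)).re : ℝ) : ℂ) * Θ (((torusChart L v m : ↥(cmBorelTriple L 3 v).M) : ↥(unitaryGroupOfForm (conjLocal L (IsCMField.complexConj L) v) (cmLocalForm L 3 v))) : Gqs L v)‖ ≤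
          C * (min ((unitModulusChar (LocalRing L v) m.1 : ℝ≥0) : ℝ) ((unitModulusChar (LocalRing L v) m.1 : ℝ≥0) : ℝ)⁻¹) ^ s) :
    ∀ m : ((LocalRing L v)ˣ × ↥(normOneUnits (conjLocal L (IsCMField.complexConj L) v))),
      m ∉ (((Submonoid.pi Set.univ (fun w : PlacesOver L v => (w.1.adicCompletionIntegers L).toSubring.toSubmonoid)).units.prod (⊤ : Subgroup ↥(normOneUnits (conjLocal L (IsCMField.complexConj L) v)))) : Subgroup ((LocalRing L v)ˣ × ↥(normOneUnits (conjLocal L (IsCMField.complexConj L) v)))) →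
        ‖(((vanDijkWeight L v (torusChart L v m)).re : ℝ) : ℂ) * Θ (((torusChart L v m : ↥(cmBorelTriple L 3 v).M) : ↥(unitaryGroupOfForm (conjLocal L (IsCMField.complexConj L) v) (cmLocalForm L 3 v))) : Gqs L v)‖ ≤
          C * (min ((unitModulusChar (LocalRing L v) m.1 : ℝ≥0) : ℝ) ((unitModulusChar (LocalRing L v) m.1 : ℝ≥0) : ℝ)⁻¹) ^ s := by
  have hw : IsCMField.complexConj L • w.1 = w.1 := hns w
  haveI := PlacesOver.subsingleton_of_smul_eq (IsCMField.complexConj L) (IsCMField.complexConj_ne_one L) w hw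
  obtain ⟨w₀, hw₀⟩ := F0P3U3PrincipalSeriesOpenCellTorusChar.exists_weylElt_three L v hns
  intro m hm
  -- `|m.1_w| ≠ 1`
  have hne : Valued.v ((m.1 : LocalRing L v) w) ≠ 1 := by
    intro h1
    refine hm (Subgroup.mem_prod.2 ⟨(F0P3cStCharTSTorusCompactPart.mem_unitsIntegers_iff L v m.1).2 fun w' => ?_, Subgroup.mem_top _⟩)
    rw [Subsingleton.elim w' w]; exact h1
  rcases lt_or_gt_of_ne hne with hlt | hgt
  · exact hdom m hm hlt
  · -- the reflected point `ω m` is dominant and off `M_c`; `Θσ (ω m) = Θσ m`; `min` is `ω`-invariant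
    set m' : ((LocalRing L v)ˣ × ↥(normOneUnits (conjLocal L (IsCMField.complexConj L) v))) :=
      ((Units.map ((conjLocal L (IsCMField.complexConj L) v : LocalRing L v →+* LocalRing L v) : LocalRing L v →* LocalRing L v) m.1)⁻¹, m.2) with hm'
    have hm'c : m' ∉ (((Submonoid.pi Set.univ (fun w : PlacesOver L v => (w.1.adicCompletionIntegers L).toSubring.toSubmonoid)).units.prod (⊤ : Subgroup ↥(normOneUnits (conjLocal L (IsCMField.complexConj L) v)))) : Subgroup ((LocalRing L v)ˣ × ↥(normOneUnits (conjLocal L (IsCMField.complexConj L) v)))) :=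
      F0P3cStCharTSHTwoOfPsi.reflect_not_mem_torusCompactPart L v hns hm
    have hm'1 : Valued.v ((m'.1 : LocalRing L v) w) < 1 := by
      show Valued.v ((((Units.map ((conjLocal L (IsCMField.complexConj L) v : LocalRing L v →+* LocalRing L v) : LocalRing L v →* LocalRing L v) m.1)⁻¹ :
        (LocalRing L v)ˣ) : LocalRing L v) w) < 1
      rw [F0P3cStCharTSHyperbolicSet.v_units_inv_apply, Units.coe_map, MonoidHom.coe_coe, F0P3cStCharTSHyperbolicSet.v_conjLocal_apply_of_nonsplit L v hns]
      exact inv_lt_one_of_one_lt₀ hgt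
    have hb := hdom m' hm'c hm'1
    -- `ι m'` is the Weyl conjugate of `ι m`
    have hι : ((torusChart L v m' : ↥(cmBorelTriple L 3 v).M) : ↥(unitaryGroupOfForm (conjLocal L (IsCMField.complexConj L) v) (cmLocalForm L 3 v))) =
        w₀ * ((torusChart L v m : ↥(cmBorelTriple L 3 v).M) : ↥(unitaryGroupOfForm (conjLocal L (IsCMField.complexConj L) v) (cmLocalForm L 3 v))) * w₀⁻¹ :=
      F0P3cStCharTSVanDijkWeylSymm.torusChart_reflect L v w₀ hw₀ m
    have hΔ : vanDijkWeight L v (torusChart L v m') = vanDijkWeight L v (torusChart L v m) :=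
      F0P3cStCharTSVanDijkWeylSymm.vanDijkWeight_weylConj L v w₀ hw₀ (torusChart L v m) (torusChart L v m') hι
    have hreg : IsRegularElt (((((torusChart L v m : ↥(cmBorelTriple L 3 v).M) : ↥(unitaryGroupOfForm (conjLocal L (IsCMField.complexConj L) v) (cmLocalForm L 3 v))) : Gqs L v)).val : GL (Fin 3) (LocalRing L v)) :=
      (F0P3cStCharTSHyperbolicCore.mem_hyperbolicSet_of_one_lt_v_trace L v hns w _
        ((F0P3cStCharTSHyperbolicSet.one_lt_v_trace_torusChart_iff L v hns w m).2 hne)).2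
    have hΘ : Θ (((torusChart L v m' : ↥(cmBorelTriple L 3 v).M) : ↥(unitaryGroupOfForm (conjLocal L (IsCMField.complexConj L) v) (cmLocalForm L 3 v))) : Gqs L v) =
        Θ (((torusChart L v m : ↥(cmBorelTriple L 3 v).M) : ↥(unitaryGroupOfForm (conjLocal L (IsCMField.complexConj L) v) (cmLocalForm L 3 v))) : Gqs L v) := by
      have h := hΘcl _ hreg (w₀ : Gqs L v)
      have h' := congrArg (fun x : ↥(unitaryGroupOfForm (conjLocal L (IsCMField.complexConj L) v) (cmLocalForm L 3 v)) => Θ (x : Gqs L v)) hι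
      exact h'.trans h
    have hmin : min ((unitModulusChar (LocalRing L v) m'.1 : ℝ≥0) : ℝ) ((unitModulusChar (LocalRing L v) m'.1 : ℝ≥0) : ℝ)⁻¹ =
        min ((unitModulusChar (LocalRing L v) m.1 : ℝ≥0) : ℝ) ((unitModulusChar (LocalRing L v) m.1 : ℝ≥0) : ℝ)⁻¹ := by
      have h1 : unitModulusChar (LocalRing L v) m'.1 = (unitModulusChar (LocalRing L v) m.1)⁻¹ := unitModulusChar_reflect_fst L v w hw m
      rw [h1, NNReal.coe_inv, inv_inv, min_comm]
    rw [hΔ, hΘ, hmin] at hb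
    exact hb


set_option maxHeartbeats 4000000 in  -- cross-spelling `whnf` (measured class, as ★ part 1)
set_option synthInstance.maxHeartbeats 400000 in
/-- **(DEC σ) — «DEC-SIGMA★»: THE SHELL DECAY OF `D_G·χ_σ` ALONG THE SPLIT TORUS FOR A SQUARE-INTEGRABLE CLASS**, in the tokens of LH6-p01 (g3)'s (TOR⁵) ∕ the `hC`
binder of ★ `F0P3cStCharTSL1MSplit.integrable_of_compactPart_bound_of_shell_decay`: for `σ` square-integrable modulo the centre and `Θ` with the (M1) clauses
(locally constant at regular elements, represents `Tr σ`) and the class-function clause (CHAR-CL) at regular elements (the integrator plugs `Θ := 𝔇.char σ`):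
`∃ C s, 0 < s ∧ ∀ m ∉ M_c, ‖(Δ(ι m)).re · Θ(ι m)‖ ≤ C · min(‖m.1‖, ‖m.1‖⁻¹)^s` — ★ part 1 `exists_exponents_char_torusChart` (CASSELMAN-CAP + TMULT + Casselman decay) on the
dominant half, ★ ④a `exists_shellDecay_min_of_exponents_of_valued` (LH6-p03 (g3)) for the geometric bound there, and the `ω`-half above.  Print: «for all square-integrable
`π`, the restriction of `D_G(γ)χ_π(γ)` to `M` is an integrable function» [L. 12.7.2 proof p. 193] — its decay half. [cite: Rogawski1990, §12.7 L. 12.7.2 (proof) p. 193]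
[cite: Casselman1977, Thm. 5.2] [cite: Casselman1995, Thm. 4.4.6] -/
theorem dec_sigma (hns : ∀ w' : PlacesOver L v, IsCMField.complexConj L • w'.1 = w'.1) (w : PlacesOver L v)
    [MeasurableSpace (Gqs L v)] [BorelSpace (Gqs L v)]
    [MeasurableSpace (Gqs L v ⧸ Subgroup.center (Gqs L v))] [BorelSpace (Gqs L v ⧸ Subgroup.center (Gqs L v))]
    (μZ : Measure (Gqs L v ⧸ Subgroup.center (Gqs L v))) [μZ.IsHaarMeasure]
    (νQv : Measure (Gqs L v)) [νQv.IsHaarMeasure]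
    (σ : IrrClass (Gqs L v)) (hσ : σ.IsSquareIntegrable μZ)
    (Θ : Gqs L v → ℂ) (hΘloc : ∀ x : Gqs L v, IsRegularElt (x.val : GL (Fin 3) (LocalRing L v)) → ∀ᶠ y in 𝓝 x, Θ y = Θ x)
    (hΘtr : ∀ φ : Gqs L v → ℂ, IsLocSmooth φ → σ.smoothTrace νQv φ = ∫ g, φ g * Θ g ∂νQv)
    (hΘcl : ∀ g : Gqs L v, IsRegularElt (g.val : GL (Fin 3) (LocalRing L v)) → ∀ h : Gqs L v, Θ (h * g * h⁻¹) = Θ g) :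
    ∃ C s : ℝ, 0 < s ∧ ∀ m : ((LocalRing L v)ˣ × ↥(normOneUnits (conjLocal L (IsCMField.complexConj L) v))), m ∉ (((Submonoid.pi Set.univ (fun w : PlacesOver L v => (w.1.adicCompletionIntegers L).toSubring.toSubmonoid)).units.prod (⊤ : Subgroup ↥(normOneUnits (conjLocal L (IsCMField.complexConj L) v)))) : Subgroup ((LocalRing L v)ˣ × ↥(normOneUnits (conjLocal L (IsCMField.complexConj L) v)))) →
      ‖(((vanDijkWeight L v (torusChart L v m)).re : ℝ) : ℂ) * Θ (((torusChart L v m : ↥(cmBorelTriple L 3 v).M) : ↥(unitaryGroupOfForm (conjLocal L (IsCMField.complexConj L) v) (cmLocalForm L 3 v))) : Gqs L v)‖ ≤ C * (min ((unitModulusChar (LocalRing L v) m.1 : ℝ≥0) : ℝ) ((unitModulusChar (LocalRing L v) m.1 : ℝ≥0) : ℝ)⁻¹) ^ s := by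
  obtain ⟨S, hSd, hval⟩ := F0P3cStCharTSCharTorusValue.exists_exponents_char_torusChart L v hns w μZ νQv σ hσ Θ hΘloc hΘtr
  obtain ⟨C, s, hs, hb⟩ := F0P3cStCharTSExpShellDecay.exists_shellDecay_min_of_exponents_of_valued L v hns w S
    (fun θ hθ => (hSd θ hθ).1) (fun θ hθ => (hSd θ hθ).2)
  refine ⟨C, s, hs, shellDecay_of_dominant_half L v hns w Θ hΘcl fun m hm hlt => ?_⟩
  rw [hval m hlt]
  exact hb m hm hlt

end Summit.HodgeConjecture.HodgeConjecture.Cruxes.H413.F0P3cStCharTSDecSigma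

end
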